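import Summits.BirchSwinnertonDyer.BirchSwinnertonDyer.Theorems.SchneiderFreeAdditiveX3PoitouTateReciprocitySumHolds
import Summits.BirchSwinnertonDyer.BirchSwinnertonDyer.Theorems.SchneiderFreeAdditiveX3PoitouTateUnramifiedOrthogonalAllLevels
import Literature.NumberTheory.GaloisCohomology.LocalInvariantMapConjCompatible
import HarnessLib

set_option linter.dupNamespace false -- `…BirchSwinnertonDyer.BirchSwinnertonDyer…` is the cell's nested layout (D-0017)
set_option autoImplicit false

/-!
# `poitouTate_selmerStructure_duality_conj K` HOLDS for every number field `K` — Poitou–Tate duality for Selmer structures in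
# the CONJUGATION-COMPATIBLE currency, witnessed by THE canonical local invariants (LADDER-BSD D-0154 (2), INPUTS TRANCHE #3b)

Seat `bsd-inputs-honda-p1` (gen 6, idle INPUTS prover of the desk `pub/bsd-wall/bsd-inputs`), `--supports`
stmt-BirchSwinnertonDyer-23092. THEOREMS ONLY (no definition, no named fact, no `sorry`); ROUTE-FREE (no `Theses/*.lean` in the import
closure), so route files and the by-name leaf files of items 23092 / 23036 may import it.

The named fact `Literature.NumberTheory.GaloisCohomology.poitouTate_selmerStructure_duality_conj K` (the four Poitou–Tate conjuncts
`IsPerfect ∧ SumLocalTermEqZero ∧ UnramifiedOrthogonal ∧ SelmerComplement` for ONE family of local invariant maps at every level `n`,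
PLUS `IsConjCompatible` under every `σ ∈ Aut(K)`; items 23092 `PoitouTateSelmerDualityConjInput` / `PoitouTateSelmerDuality` of
`SemiOrdinaryEisensteinDescent` / `PrintX9` / `PrintX10b` and 23036 `HeldPoitouTateSelmerDuality` of the two `KatoDescent*PotSupersingular`
routes) follows for THE canonical family `LocalInvariants.canonical K n` from bsd-jet's
`poitouTate_selmerStructure_duality_conj_of_canonical_numberField K hUO hSC` (`LocalInvariantMapConjCompatible`; perfectness,
`∑ inv_v = 0` and conjugation-compatibility of the canonical maps are tree theorems there) once its two inputs are supplied:
`hUO` — `SchneiderFreeAdditiveX3.PoitouTateReduction.unramifiedOrthogonal_of_isPerfect_allLevels (LocalInvariants.canonical K n)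
LocalInvariants.canonical_isPerfect` (bsd-schneider door-c4, `…PoitouTateUnramifiedOrthogonalAllLevels`), and `hSC` — since 2026-08-28T11:03Z
a THEOREM OF THE TREE: `SchneiderFreeAdditiveX3.PoitouTateReduction.selmerComplement_canonical_holds (K) (n)` (door-c4 g18, p626891,
`…PoitouTateReciprocitySumHolds`). This is exactly the desk's certified shape `T11-PT1DischargeShapes.lean` (plan-1 g9)
`soed_poitouTateSelmerDualityConjInput_of hSC` with `hSC` discharged. Nothing is re-derived; no landed declaration is restated.

Honest framing: an UNCONDITIONAL theorem about finite Galois modules over number fields (classical Poitou–Tate / Howard 2.1.11 / Milne I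
2.6 for the canonical invariant maps), kernel-checked by the `bsd-schneider` and `bsd-jet` cells and only composed here. It closes nothing by
itself (the by-name leaf files do); PT2 `poitouTate_sha_tateDual` stays OPEN; no crux of substance and no summit statement is proved; the
Birch–Swinnerton-Dyer conjecture is NOT proved by any of this.
References: [MilneADT2006] Ch. I, Cor. 2.3, Thm. 2.6, Thm. 4.10 (b); [Howard2004HeegnerKolyvagin] Thm. 2.1.11; [MazurRubin2004] Thm. 2.3.4;
[CasselsFrohlichANT1967] Ch. VII.
-/

namespace Summit.BirchSwinnertonDyer.BirchSwinnertonDyer.Theorems.InputsPoitouTateSelmer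

open Literature.NumberTheory.GaloisCohomology

section ConjHolds

/-! The one parameter of the named fact (the number field); the discharge below is the closed statement at every `K`. -/
variable (K : Type) [Field K] [NumberField K]

/-- **`poitouTate_selmerStructure_duality_conj K` for EVERY number field `K`** (Milne *ADT* I Cor. 2.3 ∧ Thm. 4.10 (b) ∧ Thm. 2.6 ∧
Howard 2004 Thm. 2.1.11, conjugation-compatible currency), for THE canonical local invariants:
`poitouTate_selmerStructure_duality_conj_of_canonical_numberField` with `UnramifiedOrthogonal` from
`SchneiderFreeAdditiveX3.PoitouTateReduction.unramifiedOrthogonal_of_isPerfect_allLevels` and `SelmerComplement` from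
`SchneiderFreeAdditiveX3.PoitouTateReduction.selmerComplement_canonical_holds` (p626891). Unconditional; BSD is not proved by this.
[cite: MilneADT2006, Ch. I, Thm. 4.10 (b) (proof, p. 58), Cor. 2.3, Thm. 2.6] [cite: Howard2004HeegnerKolyvagin, Thm. 2.1.11 (arXiv:1202.6340 p. 6)] -/
theorem poitouTate_selmerStructure_duality_conj_holds : poitouTate_selmerStructure_duality_conj K :=
  poitouTate_selmerStructure_duality_conj_of_canonical_numberField K
    (fun n _ => SchneiderFreeAdditiveX3.PoitouTateReduction.unramifiedOrthogonal_of_isPerfect_allLevels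
      (LocalInvariants.canonical K n) LocalInvariants.canonical_isPerfect)
    (fun n _ => SchneiderFreeAdditiveX3.PoitouTateReduction.selmerComplement_canonical_holds K n)

end ConjHolds

end Summit.BirchSwinnertonDyer.BirchSwinnertonDyer.Theorems.InputsPoitouTateSelmer
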